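import Summits.Langlands.Langlands.Theorems.SoloInformedGLOneRealPlace
import HarnessLib

/-!
# Λ28 — The exact residue of the repaired `GL₁` summit: rank-one Fontaine–Mazur for `K`

Solo (informed) programme, rung Λ28 (bookkeeping for Λ26–Λ27).  With clause (A⁺)₁ a theorem for
every number field with a real place (Λ27 `automorphicToGaloisR3plus_one_of_isReal`), Λ23's
fact-free normal form `globalLanglandsCorrespondenceGLnR3plus_one_iff_weilRep` collapses: over such a
field the R3⁺-repaired `n = 1` conjunct is EQUIVALENT — not merely implied by — the `K`-instance of
rank-one Fontaine–Mazur for THE pinned datum ("every `ρ : Γ_K → GL₁(ℚ̄_ℓ)` de Rham at every `v ∣ ℓ`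
is a Weil character `r_{θ,ι}`"), with no named fact on either side; over an arbitrary number field it
is equivalent to that instance together with (de Rham ∧ Hodge–Tate compatible above `ℓ`) for the Weil
characters of the non-parallel Hecke characters.

* `globalLanglandsCorrespondenceGLnR3plus_one_iff_nonparallel_and_fm` (any `K`, no named fact);
* ★★★ `globalLanglandsCorrespondenceGLnR3plus_one_iff_fm_of_isReal` / `…_of_odd_finrank`: over a field
  with a real place (e.g. of odd degree) the repaired `GL₁` summit ⟺ rank-one Fontaine–Mazur for `K`;
* `fontaineMazurOne_of_globalLanglandsCorrespondenceGLnR3plus_one`: conversely, over any `K` the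
  repaired conjunct implies that instance; the named fact FM₁
  (`FramedGaloisRep.exists_heckeCharacter_of_isDeRhamFramed`) supplies it (Λ22
  `exists_eq_weilRep_of_isDeRhamFramed`), recovering Λ27's theorems granting FM₁.

Plain theorems; no definitions (the `K`-instance is spelled out, not named).

Citations: [FontaineMazurGeometric1995] Conj. 1 and §1; [Patrikis2019] Prop. 2.2.1;
[BuzzardGeeLMS2014] Conj. 3.2.1–3.2.2, Rem. 3.2.3 and Rem. 3.2.5; [Weil1956] §1;
[SerreAbelianLadic1968] Ch. III §2.3 and App. A.
-/

noncomputable section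
open scoped MatrixGroups Matrix Classical Polynomial NumberField
open NumberField IsDedekindDomain Field Polynomial Filter
open Literature.NumberTheory.Automorphic Literature.NumberTheory.GaloisRepresentations
open Literature.NumberTheory.PAdicHodge

namespace Summit.Langlands.Langlands.Theorems

namespace GLOneRigidity

section ResidualFM

variable {K : Type} [Field K] [NumberField K] {hcpt : isCompact_glFiniteIntegralLevel 1 K}

/-- ★★ **The R3⁺-repaired `n = 1` conjunct over `K`, fact-free normal form after Λ26**: it holds iff
(i) the Weil characters of the NON-parallel algebraic Hecke characters are de Rham and Hodge–Tate
compatible above every `ℓ`, and (ii) every rank-one `ρ` that the pinned datum declares de Rham at every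
`v ∣ ℓ` is a Weil character (rank-one Fontaine–Mazur for `K`).  (Λ23
`globalLanglandsCorrespondenceGLnR3plus_one_iff_weilRep` with the parallel part of (i) discharged by
Λ26 `automorphicToGaloisR3plus_one_iff_nonparallel`.) [cite: BuzzardGeeLMS2014, Conj. 3.2.1–3.2.2 and Rem. 3.2.3]
[cite: FontaineMazurGeometric1995, Conj. 1] [cite: Weil1956, §1] -/
theorem globalLanglandsCorrespondenceGLnR3plus_one_iff_nonparallel_and_fm (𝓡 : ReciprocityData K) :
    R3plus.GlobalLanglandsCorrespondenceGLnR3plus 1 K 𝓡 hcpt ↔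
      (∀ (π : CuspidalAutomorphicRepData 1 K hcpt) (θ : HeckeCharacter K),
        (∀ (g : (AdelicGroupData.gl 1 K).Adelic), ∀ φ ∈ π.1.W,
          rightTranslation (AdelicGroupData.gl 1 K) g φ -
            ((θ (Matrix.GeneralLinearGroup.det g) : ℂˣ) : ℂ) • φ ∈ π.1.W') →
        ∀ (p q : InfinitePlace K → ℤ) (hinf : θ.HasInfinityType p q),
          (¬ ∃ n₀ : ℤ, ∀ φ : K →+* ℂ, HeckeCharacter.embExponent p q φ = n₀) →
          ∀ (T : Finset (HeightOneSpectrum (𝓞 K))) (e : HeightOneSpectrum (𝓞 K) → ℕ)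
            (hmod : HeckeCharacter.IsModulus θ T e) (ℓ : ℕ) [Fact ℓ.Prime] (ι : PadicAlgCl ℓ ≃+* ℂ),
            (∀ (v : HeightOneSpectrum (𝓞 K)) (hv : ((ℓ : ℕ) : 𝓞 K) ∈ v.asIdeal),
              (𝓡.pst ℓ v hv).IsDeRhamFramed ((hinf.weilRep hmod ι).toLocal v)) ∧
            ∀ (v : HeightOneSpectrum (𝓞 K)) (hv : ((ℓ : ℕ) : 𝓞 K) ∈ v.asIdeal),
              R3plus.HodgeTateCompatibleAt 𝓡 ι π.1 (hinf.weilRep hmod ι) v hv) ∧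
      ∀ (ℓ : ℕ) [Fact ℓ.Prime] (ι : PadicAlgCl ℓ ≃+* ℂ) (ρ : FramedGaloisRep K (PadicAlgCl ℓ) 1),
        (∀ (v : HeightOneSpectrum (𝓞 K)) (hv : ((ℓ : ℕ) : 𝓞 K) ∈ v.asIdeal),
          (𝓡.pst ℓ v hv).IsDeRhamFramed (ρ.toLocal v)) →
        ∃ (θ : HeckeCharacter K) (p q : InfinitePlace K → ℤ) (hinf : θ.HasInfinityType p q)
          (T : Finset (HeightOneSpectrum (𝓞 K))) (e : HeightOneSpectrum (𝓞 K) → ℕ)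
          (hmod : HeckeCharacter.IsModulus θ T e), ρ = hinf.weilRep hmod ι := by
  rw [globalLanglandsCorrespondenceGLnR3plus_one_iff_weilRep 𝓡]
  refine and_congr_left fun _ => ?_
  rw [← automorphicToGaloisR3plus_one_iff_nonparallel 𝓡, automorphicToGaloisR3plus_one_iff_weilRep 𝓡]
  exact ⟨fun h π θ hχ p q hinf T e hmod ℓ _ ι =>
      ⟨fun v hv => (h π θ hχ p q hinf T e hmod ℓ ι v hv).1,
        fun v hv => (h π θ hχ p q hinf T e hmod ℓ ι v hv).2⟩,
    fun h π θ hχ p q hinf T e hmod ℓ _ ι v hv =>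
      ⟨(h π θ hχ p q hinf T e hmod ℓ ι).1 v hv, (h π θ hχ p q hinf T e hmod ℓ ι).2 v hv⟩⟩

/-- ★★★ **Over a number field with a real place, the R3⁺-repaired `GL₁` summit is EQUIVALENT to
rank-one Fontaine–Mazur for `K` (pinned datum)** — every `ρ : Γ_K → GL₁(ℚ̄_ℓ)` de Rham at every
`v ∣ ℓ` is Weil's `r_{θ,ι}` for an algebraic Hecke character `θ` — with no named fact on either side:
part (i) of the previous theorem is vacuous by Λ27 `exists_embExponent_eq_of_isReal`.
[cite: FontaineMazurGeometric1995, Conj. 1] [cite: Patrikis2019, Prop. 2.2.1]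
[cite: BuzzardGeeLMS2014, Conj. 3.2.1–3.2.2, Rem. 3.2.3 and Rem. 3.2.5] [cite: Weil1956, §1] -/
theorem globalLanglandsCorrespondenceGLnR3plus_one_iff_fm_of_isReal {w : InfinitePlace K}
    (hw : w.IsReal) (𝓡 : ReciprocityData K) :
    R3plus.GlobalLanglandsCorrespondenceGLnR3plus 1 K 𝓡 hcpt ↔
      ∀ (ℓ : ℕ) [Fact ℓ.Prime] (ι : PadicAlgCl ℓ ≃+* ℂ) (ρ : FramedGaloisRep K (PadicAlgCl ℓ) 1),
        (∀ (v : HeightOneSpectrum (𝓞 K)) (hv : ((ℓ : ℕ) : 𝓞 K) ∈ v.asIdeal),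
          (𝓡.pst ℓ v hv).IsDeRhamFramed (ρ.toLocal v)) →
        ∃ (θ : HeckeCharacter K) (p q : InfinitePlace K → ℤ) (hinf : θ.HasInfinityType p q)
          (T : Finset (HeightOneSpectrum (𝓞 K))) (e : HeightOneSpectrum (𝓞 K) → ℕ)
          (hmod : HeckeCharacter.IsModulus θ T e), ρ = hinf.weilRep hmod ι := by
  rw [globalLanglandsCorrespondenceGLnR3plus_one_iff_nonparallel_and_fm 𝓡]
  exact ⟨fun h => h.2, fun h =>
    ⟨fun _ _ _ _ _ hinf hpar => absurd (exists_embExponent_eq_of_isReal hw hinf) hpar, h⟩⟩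

/-- ★★★ **Over a number field of odd degree, the R3⁺-repaired `GL₁` summit ⟺ rank-one Fontaine–Mazur
for `K`.** [cite: FontaineMazurGeometric1995, Conj. 1] [cite: Patrikis2019, Prop. 2.2.1]
[cite: BuzzardGeeLMS2014, Conj. 3.2.1–3.2.2 and Rem. 3.2.5] -/
theorem globalLanglandsCorrespondenceGLnR3plus_one_iff_fm_of_odd_finrank
    (hodd : Odd (Module.finrank ℚ K)) (𝓡 : ReciprocityData K) :
    R3plus.GlobalLanglandsCorrespondenceGLnR3plus 1 K 𝓡 hcpt ↔
      ∀ (ℓ : ℕ) [Fact ℓ.Prime] (ι : PadicAlgCl ℓ ≃+* ℂ) (ρ : FramedGaloisRep K (PadicAlgCl ℓ) 1),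
        (∀ (v : HeightOneSpectrum (𝓞 K)) (hv : ((ℓ : ℕ) : 𝓞 K) ∈ v.asIdeal),
          (𝓡.pst ℓ v hv).IsDeRhamFramed (ρ.toLocal v)) →
        ∃ (θ : HeckeCharacter K) (p q : InfinitePlace K → ℤ) (hinf : θ.HasInfinityType p q)
          (T : Finset (HeightOneSpectrum (𝓞 K))) (e : HeightOneSpectrum (𝓞 K) → ℕ)
          (hmod : HeckeCharacter.IsModulus θ T e), ρ = hinf.weilRep hmod ι := by
  obtain ⟨w, hw⟩ := exists_isReal_of_odd_finrank (K := K) hodd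
  exact globalLanglandsCorrespondenceGLnR3plus_one_iff_fm_of_isReal hw 𝓡

/-- **The other direction of the bookkeeping: the repaired `GL₁` summit over ANY number field implies
rank-one Fontaine–Mazur for `K`** (its clause (B⁺)₁ read through rigidity; no named fact).
[cite: FontaineMazurGeometric1995, Conj. 1] [cite: BuzzardGeeLMS2014, Conj. 3.2.2] -/
theorem fontaineMazurOne_of_globalLanglandsCorrespondenceGLnR3plus_one (𝓡 : ReciprocityData K)
    (h : R3plus.GlobalLanglandsCorrespondenceGLnR3plus 1 K 𝓡 hcpt)
    {ℓ : ℕ} [Fact ℓ.Prime] (ι : PadicAlgCl ℓ ≃+* ℂ) (ρ : FramedGaloisRep K (PadicAlgCl ℓ) 1)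
    (hdR : ∀ (v : HeightOneSpectrum (𝓞 K)) (hv : ((ℓ : ℕ) : 𝓞 K) ∈ v.asIdeal),
      (𝓡.pst ℓ v hv).IsDeRhamFramed (ρ.toLocal v)) :
    ∃ (θ : HeckeCharacter K) (p q : InfinitePlace K → ℤ) (hinf : θ.HasInfinityType p q)
      (T : Finset (HeightOneSpectrum (𝓞 K))) (e : HeightOneSpectrum (𝓞 K) → ℕ)
      (hmod : HeckeCharacter.IsModulus θ T e), ρ = hinf.weilRep hmod ι :=
  ((globalLanglandsCorrespondenceGLnR3plus_one_iff_nonparallel_and_fm 𝓡).mp h).2 ℓ ι ρ hdR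

end ResidualFM

end GLOneRigidity

end Summit.Langlands.Langlands.Theorems

end
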